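import Literature.AlgebraicGeometry.HodgeTheory.HodgeFiltrationChartBallFramesOfFamily
import Literature.AlgebraicGeometry.HodgeTheory.HodgeFramesOfChartBallFrames
import Literature.AlgebraicGeometry.HodgeTheory.GriffithsHolomorphicHodgeSubbundlesQP
import HarnessLib

/-!
# Griffiths' theorem «the Hodge bundles `F^p𝓗^k` are holomorphic subbundles» for smooth projective
# families with quasi-projective total space — the discharge of `Griffiths1968_holomorphicHodgeSubbundlesQP`

Topic: Hodge theory in families (Griffiths 1968 Thm. 1.1; Voisin (2002), §10.2.1 Thm. 10.3 with
§10.1.2 Thm. 10.9 and §10.2.2). One theorem, no definition, no named fact. Written by the prover seat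
`hodge-nonav-prover-Bx` (g18, cell `hodge-nonav`) as the END PRODUCT **K7-final** of the cell's
programme «GRIFFITHS-HOLOMORPHY» (memo `PROGRAMME-GRIFFITHS-HOLOMORPHY-Bx-g17.md`; bricks K0–K7 by the
seats `hodge-nonav-19716-p2`, `hodge-nonav-20241-p1`, `hodge-nonav-prover-Bx`).

`griffiths1968_holomorphicHodgeSubbundlesQP_holds : Griffiths1968_holomorphicHodgeSubbundlesQP` — for a
smooth projective family `f : 𝒳 ⟶ S` of relative dimension `n` with `S` and `𝒳` smooth quasi-projective,
every degree `k`, every `p`, and every point `t₁` of `S(ℂ)`: near `t₁` the steps `F^pH^k(X_t)` of the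
Hodge filtrations of the fibres, read on `ℂ ⊗ H^k(X_s; ℚ)` along flat continuation, are framed by
linearly independent vectors with holomorphic coordinates (the subbundle-frame form of the statement).

Proof = two tree theorems composed: `exists_chartBall_hodgeFrames` (this seat; the harmonic route of
Voisin §10.2.2 — Kähler metric on `𝒳(ℂ)`, Ehresmann chart-ball trivialisation, the continuous family of
harmonic projectors whose kernels are the transported `F^p`, constancy of `dim F^p`, Osgood kernel
frames; and the degenerate degrees `k ≥ 2n`) supplies analytic frames of `(e z)^* F^pH^k(X_{c⁻¹ z})` in
`H^k_dR(X_{t₁}; ℂ)` over a chart ball, and `exists_hodgeFrames_of_chartBallFrames`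
(`hodge-nonav-20241-p1`) transports them to the Betti side along the flat continuations and the de Rham
comparison, producing the target tail verbatim (its unused hypothesis `∃ δ₁, …` is discarded).

Honest scope: this proves the tree's statement `Griffiths1968_holomorphicHodgeSubbundlesQP` (quasi-
projective total space); the named fact `Griffiths1968_holomorphicHodgeSubbundles` for proper
non-projective families is NOT touched, and nothing here says HC or any rung is proved.

## References

* [Griffiths1968PeriodsII] P. Griffiths, Periods of integrals on algebraic manifolds II, Amer. J. Math.
  90 (1968), Thm. 1.1.
* [VoisinHodgeI2002] C. Voisin, Hodge Theory and Complex Algebraic Geometry I, CUP (2002), §10.2.1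
  Thm. 10.3, §10.1.2 Thm. 10.9, §10.2.2.
-/

noncomputable section

open CategoryTheory AlgebraicGeometry
open _root_.Topology _root_.Filter
open Literature.AlgebraicTopology.SingularHomology
open Literature.AlgebraicGeometry.Motives

namespace Literature.AlgebraicGeometry.HodgeTheory

/-- **Griffiths' theorem (Voisin I Thm. 10.3; Griffiths 1968 Thm. 1.1) for smooth projective families
with quasi-projective total space: the Hodge bundles `F^p𝓗^k ⊂ 𝓗^k` are holomorphic subbundles** —
the tree's statement `Griffiths1968_holomorphicHodgeSubbundlesQP`, PROVED (chart-ball analytic frames of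
the transported Hodge filtration, `exists_chartBall_hodgeFrames`, packaged on the Betti side by
`exists_hodgeFrames_of_chartBallFrames`). [cite: VoisinHodgeI2002, §10.2.1 Thm. 10.3 and §10.2.2]
[cite: Griffiths1968PeriodsII, Thm. 1.1] -/
theorem griffiths1968_holomorphicHodgeSubbundlesQP_holds : Griffiths1968_holomorphicHodgeSubbundlesQP := by
  intro 𝒳 S f n k d hf hS h𝒳 _ hU A hA _ s t₁ N hN
  haveI : AlgebraicGeometry.IsSeparated S.hom := hS.isVarietyPair_ofScheme.isSeparated
  obtain ⟨r, Φ, e, r₀, R, w, -, -, hΦ0, -, hΦsm, -, he, hr₀, hr₀r, hwan, hwframe⟩ :=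
    exists_chartBall_hodgeFrames f (d := d) k hf h𝒳 t₁.1
  obtain ⟨W₀, hW₀o, ht₁W₀, hW₀N, hW₀pc, ψ, hW₀ψ, hK7h⟩ :=
    exists_hodgeFrames_of_chartBallFrames f hf hU A hA k s t₁ N hN Φ hΦ0 hΦsm e he
      (fun p ↦ ⟨r₀, hr₀, hr₀r, R p, w p, hwan p, hwframe p⟩)
  exact ⟨W₀, hW₀o, ht₁W₀, hW₀N, hW₀pc, ψ, hW₀ψ, fun T₁ _ p ↦ hK7h T₁ p⟩

end Literature.AlgebraicGeometry.HodgeTheory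

end
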